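import Mathlib.Analysis.SpecialFunctions.Gaussian.GaussianIntegral
import Mathlib.MeasureTheory.Integral.Pi
import Mathlib.MeasureTheory.Group.Integral
import Literature.Probability.LatticeModels.IsingModel
import HarnessLib

/-!
# The Kac–Siegert (Hubbard–Stratonovich) transform of a finite Ising model: exactness

Topic `Literature/Probability/LatticeModels`; companion of `HSLangevinPairChain.lean` (definition
request `defn-HSLangevinPairChain`, route CriticalPhenomena/Ising3DConformalLimit
`SynchronousCoupling`), self-contained (imports only `IsingModel`).

Let `V` be finite and `M : Matrix V V ℝ` symmetric and coercive (`c ∑ ψ_x² ≤ ψᵀMψ`, `c > 0`).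
Completing the square, `exp(-½ψᵀMψ + σᵀMψ) = exp(½σᵀMσ) · exp(-½(ψ-σ)ᵀM(ψ-σ))` for every spin
configuration `σ ∈ {±1}^V ⊆ ℝ^V` (`jointWeight_eq`), so with `C_M = ∫ exp(-½ψᵀMψ) dψ ∈ (0, ∞)`:

* the FIELD WEIGHT `fieldWeight M ψ = ∑_σ exp(-½ψᵀMψ + σᵀMψ) = exp(-½ψᵀMψ) ∏_x (e^{(Mψ)_x} +
  e^{-(Mψ)_x})` (`fieldWeight_eq_exp_mul_prod`) integrates to `C_M ∑_σ exp(½σᵀMσ)`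
  (`integral_fieldWeight`), and the normalised FIELD LAW `fieldMeasure M` (density `∝ fieldWeight`
  w.r.t. Lebesgue measure on `V → ℝ`) is a probability measure (`isProbabilityMeasure_fieldMeasure`);
* conditionally on `ψ` the spins are independent with means `tanh((Mψ)_x)`, and EXACTNESS OF THE
  TWO-POINT READ-OUT holds: for `x ≠ y`,
  `∫ tanh((Mψ)_x) tanh((Mψ)_y) fieldMeasure(dψ) = ∑_σ σ_xσ_y e^{½σᵀMσ} / ∑_σ e^{½σᵀMσ}`
  (`integral_tanh_mul_tanh_fieldMeasure`), i.e. `= ⟨σ_xσ_y⟩` of the Ising model with coupling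
  operator `M` (`gibbsTwoPoint M x y`). The identification of `gibbsTwoPoint (κ·1 + β·J_G)` with
  the nearest-neighbour Ising two-point function `isingTwoPoint G univ β 0 free` /
  `isingTorusTwoPoint` (`½σᵀMσ = ½κ|V| + β ∑_{edges} σσ`) and the coercivity of `κ·1 + β·J_G` for
  `κ > |β|Δ(G)` are in the sibling file `KacSiegertIsing.lean`. The diagonal `x = y` is excluded:
  there `E[σ_x²] = 1` while `E tanh² < 1`.

This is the `t = 0` case of the Gaussian (renormalised-measure) decomposition of the Ising measure,
Bauerschmidt–Dagallier (CPAM 2024) §1.2, Bauerschmidt–Bodineau–Dagallier (Probab. Surveys 2024)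
§6.4.1, written in the preconditioned variable `ψ = M⁻¹φ` used by the route (so that the
conditional external field is `Mψ`); classical names: Kac–Siegert / Hubbard–Stratonovich. All
statements here are PROVED; no named facts are introduced.
-/

noncomputable section

open MeasureTheory Matrix Finset Real

namespace Literature.Probability.LatticeModels

namespace KacSiegert

variable {V : Type*}

/-! ### Spin configurations as real vectors; the Gibbs weight of a coupling operator -/

/-- A spin configuration as a real vector `σ ∈ {±1}^V ⊆ ℝ^V`. [folklore] -/
def spinVec (σ : SpinConfig V) : V → ℝ := fun x => spinAt x σ

/-- `spinVec` in coordinates. [folklore] -/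
@[simp] theorem spinVec_apply (σ : SpinConfig V) (x : V) : spinVec σ x = spinAt x σ := rfl

variable [Fintype V]

/-- The zero-field Gibbs weight `exp(½ σᵀMσ)` of the coupling operator `M` (for `M = κ·1 + β·J`
this is `e^{κ|V|/2} exp(β ∑_{x∼y} σ_xσ_y)`; Bauerschmidt–Dagallier 2024, eq. (1.1) up to the sign
convention `A = -M/β`). [cite: BauerschmidtDagallier2023, §1.1] -/
def gibbsWeight (M : Matrix V V ℝ) (σ : SpinConfig V) : ℝ :=
  Real.exp ((spinVec σ ⬝ᵥ M *ᵥ spinVec σ) / 2)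

/-- Gibbs weights are positive. [folklore] -/
theorem gibbsWeight_pos (M : Matrix V V ℝ) (σ : SpinConfig V) : 0 < gibbsWeight M σ :=
  Real.exp_pos _

/-! ### The Kac–Siegert weights -/

/-- The Gaussian weight `exp(-½ ψᵀMψ)`. [folklore] -/
def gaussWeight (M : Matrix V V ℝ) (ψ : V → ℝ) : ℝ :=
  Real.exp (-(ψ ⬝ᵥ M *ᵥ ψ) / 2)

/-- The JOINT Kac–Siegert weight of a spin configuration and a field,
`exp(-½ ψᵀMψ + σᵀMψ)`: its `σ`-sum is the field weight, its `ψ`-integral is `C_M e^{½σᵀMσ}`, and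
for fixed `ψ` it is proportional to the product Bernoulli law with external field `Mψ`
(BBD 2024 §6.4.1 at `t = 0`, in the variable `ψ = M⁻¹φ`). [cite: BauerschmidtBodineauDagallier2024Polchinski, §6.4.1] -/
def jointWeight (M : Matrix V V ℝ) (σ : SpinConfig V) (ψ : V → ℝ) : ℝ :=
  Real.exp (-(ψ ⬝ᵥ M *ᵥ ψ) / 2 + spinVec σ ⬝ᵥ M *ᵥ ψ)

/-! ### Completing the square -/

/-- For symmetric `M`: `-½ψᵀMψ + σᵀMψ = ½σᵀMσ - ½(ψ-σ)ᵀM(ψ-σ)`, i.e.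
`jointWeight M σ ψ = gibbsWeight M σ · gaussWeight M (ψ - σ)` (the Gaussian convolution
identity behind the Kac–Siegert transform; BD 2024 §1.2, eq. for `e^{-½(σ,C⁻¹σ)}`). [cite: BauerschmidtDagallier2023, §1.2] -/
theorem jointWeight_eq (M : Matrix V V ℝ) (hM : M.IsSymm) (σ : SpinConfig V) (ψ : V → ℝ) :
    jointWeight M σ ψ = gibbsWeight M σ * gaussWeight M (ψ - spinVec σ) := by
  unfold jointWeight gibbsWeight gaussWeight
  rw [← Real.exp_add]
  congr 1
  have hsym : spinVec σ ⬝ᵥ M *ᵥ ψ = ψ ⬝ᵥ M *ᵥ spinVec σ := by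
    rw [dotProduct_mulVec, ← mulVec_transpose, hM.eq, dotProduct_comm]
  rw [mulVec_sub, sub_dotProduct, dotProduct_sub, dotProduct_sub, hsym]
  ring

/-! ### Gaussian integrability and translation invariance -/

/-- Coercivity hypothesis on the coupling operator: `c ∑_x ψ_x² ≤ ψᵀMψ` with `c > 0` (for
symmetric `M` this is positive definiteness, in the quantitative form the estimates use). [folklore] -/
def IsCoercive (M : Matrix V V ℝ) (c : ℝ) : Prop :=
  0 < c ∧ ∀ ψ : V → ℝ, c * ∑ x, ψ x ^ 2 ≤ ψ ⬝ᵥ M *ᵥ ψ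

/-- `ψ ↦ ψᵀMψ` is continuous. [folklore] -/
theorem continuous_quadForm (M : Matrix V V ℝ) : Continuous fun ψ : V → ℝ => ψ ⬝ᵥ M *ᵥ ψ := by
  unfold dotProduct mulVec
  fun_prop

/-- The Gaussian weight is continuous. [folklore] -/
theorem continuous_gaussWeight (M : Matrix V V ℝ) : Continuous (gaussWeight M) :=
  Real.continuous_exp.comp ((continuous_quadForm M).neg.div_const _)

/-- A coercive Gaussian weight is integrable for Lebesgue measure on `V → ℝ` (domination by the
product `∏_x exp(-½c ψ_x²)` of one-dimensional Gaussians). [folklore] -/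
theorem integrable_gaussWeight {M : Matrix V V ℝ} {c : ℝ} (hM : IsCoercive M c) :
    Integrable (gaussWeight M) := by
  have hprod : Integrable (fun ψ : V → ℝ => ∏ x, Real.exp (-(c / 2) * ψ x ^ 2))
      (volume : Measure (V → ℝ)) := by
    have h := Integrable.fintype_prod (ι := V) (μ := fun _ : V => (volume : Measure ℝ))
      (f := fun (_ : V) (t : ℝ) => Real.exp (-(c / 2) * t ^ 2))
      (fun _ => integrable_exp_neg_mul_sq (by linarith [hM.1]))
    simpa [volume_pi] using h
  refine hprod.mono' (continuous_gaussWeight M).aestronglyMeasurable (Filter.Eventually.of_forall ?_)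
  intro ψ
  rw [gaussWeight, Real.norm_of_nonneg (Real.exp_pos _).le, ← Real.exp_sum]
  refine Real.exp_le_exp.2 ?_
  have h := hM.2 ψ
  have hsum : ∑ x, -(c / 2) * ψ x ^ 2 = -(c / 2) * ∑ x, ψ x ^ 2 := by rw [Finset.mul_sum]
  rw [hsum]
  linarith

/-- The Gaussian mass `C_M = ∫ exp(-½ψᵀMψ) dψ` is positive. [folklore] -/
theorem integral_gaussWeight_pos {M : Matrix V V ℝ} {c : ℝ} (hM : IsCoercive M c) :
    0 < ∫ ψ, gaussWeight M ψ := by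
  unfold gaussWeight
  exact integral_exp_pos (integrable_gaussWeight hM)

/-- `exp(σᵀa) = ∏_x exp(σ_x a_x)`. [folklore] -/
theorem exp_spinVec_dotProduct (σ : SpinConfig V) (a : V → ℝ) :
    Real.exp (spinVec σ ⬝ᵥ a) = ∏ x, Real.exp (((σ x : ℤ) : ℝ) * a x) := by
  rw [dotProduct, Real.exp_sum]
  rfl

/-- Each joint weight is an integrable function of the field, with integral `C_M e^{½σᵀMσ}`
(translation invariance of Lebesgue measure). [cite: BauerschmidtDagallier2023, §1.2] -/
theorem integral_jointWeight {M : Matrix V V ℝ} {c : ℝ} (hM : IsCoercive M c) (hsymm : M.IsSymm)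
    (σ : SpinConfig V) :
    Integrable (jointWeight M σ) ∧
      ∫ ψ, jointWeight M σ ψ = gibbsWeight M σ * ∫ ψ, gaussWeight M ψ := by
  have hfun : jointWeight M σ = fun ψ => gibbsWeight M σ * gaussWeight M (ψ - spinVec σ) :=
    funext fun ψ => jointWeight_eq M hsymm σ ψ
  rw [hfun]
  refine ⟨((integrable_gaussWeight hM).comp_sub_right (spinVec σ)).const_mul _, ?_⟩
  rw [integral_const_mul, integral_sub_right_eq_self (μ := volume) (gaussWeight M) (spinVec σ)]

variable [DecidableEq V]

/-- The Gibbs two-point function of the coupling operator `M`: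
`⟨σ_xσ_y⟩_M = ∑_σ σ_xσ_y e^{½σᵀMσ} / ∑_σ e^{½σᵀMσ}`. [cite: BauerschmidtDagallier2023, §1.1] -/
def gibbsTwoPoint (M : Matrix V V ℝ) (x y : V) : ℝ :=
  (∑ σ : SpinConfig V, spinAt x σ * spinAt y σ * gibbsWeight M σ) / ∑ σ : SpinConfig V, gibbsWeight M σ

/-- The FIELD WEIGHT (unnormalised density of the Kac–Siegert field `ψ`):
`fieldWeight M ψ = ∑_σ exp(-½ψᵀMψ + σᵀMψ) = exp(-½ψᵀMψ) ∏_x (e^{(Mψ)_x} + e^{-(Mψ)_x})`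
(the renormalised measure `ν_0 ∝ e^{-V_0} dP` of BBD 2024 §6.4.1 in the variable `ψ`). [cite: BauerschmidtBodineauDagallier2024Polchinski, §6.4.1] -/
def fieldWeight (M : Matrix V V ℝ) (ψ : V → ℝ) : ℝ :=
  ∑ σ : SpinConfig V, jointWeight M σ ψ

/-- The normalised Kac–Siegert FIELD LAW on `V → ℝ`: Lebesgue measure with density `fieldWeight M`,
divided by its total mass. (A probability measure when `M` is coercive,
`isProbabilityMeasure_fieldMeasure`; the junk value `0` if the mass is infinite.) [cite: BauerschmidtBodineauDagallier2024Polchinski, §6.4.1] -/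
def fieldMeasure (M : Matrix V V ℝ) : Measure (V → ℝ) :=
  (∫⁻ ψ, ENNReal.ofReal (fieldWeight M ψ))⁻¹ •
    (volume : Measure (V → ℝ)).withDensity fun ψ => ENNReal.ofReal (fieldWeight M ψ)

/-! ### Sums over spin configurations -/

/-- `∑_{σ ∈ {±1}^V} ∏_x g_x(σ_x) = ∏_x (g_x(1) + g_x(-1))`. [folklore] -/
theorem sum_prod_units (g : V → ℤˣ → ℝ) :
    ∑ σ : SpinConfig V, ∏ x, g x (σ x) = ∏ x, (g x 1 + g x (-1)) := by
  classical
  have h := Finset.prod_univ_sum (fun _ : V => (Finset.univ : Finset ℤˣ)) g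
  rw [Fintype.piFinset_univ] at h
  rw [← h]
  refine Finset.prod_congr rfl fun x _ => ?_
  rw [UnitsInt.univ, Finset.sum_pair (by decide)]

/-- The Bernoulli partition sum: `∑_σ exp(σᵀa) = ∏_x (e^{a_x} + e^{-a_x})`. [folklore] -/
theorem sum_exp_spinVec_dotProduct (a : V → ℝ) :
    ∑ σ : SpinConfig V, Real.exp (spinVec σ ⬝ᵥ a) = ∏ x, (Real.exp (a x) + Real.exp (-a x)) := by
  simp_rw [exp_spinVec_dotProduct]
  rw [sum_prod_units (fun x (s : ℤˣ) => Real.exp (((s : ℤ) : ℝ) * a x))]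
  simp

/-- The Bernoulli two-point sum: for `x ≠ y`,
`∑_σ σ_xσ_y exp(σᵀa) = tanh(a_x) tanh(a_y) ∏_z (e^{a_z} + e^{-a_z})` — conditionally on the field
the spins are independent with means `tanh`. [cite: BauerschmidtBodineauDagallier2024Polchinski, §6.4.1] -/
theorem sum_spin_mul_spin_mul_exp (a : V → ℝ) {x y : V} (hxy : x ≠ y) :
    ∑ σ : SpinConfig V, spinAt x σ * spinAt y σ * Real.exp (spinVec σ ⬝ᵥ a) =
      Real.tanh (a x) * Real.tanh (a y) * ∏ z, (Real.exp (a z) + Real.exp (-a z)) := by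
  classical
  -- write the summand as a product over sites
  set g : V → ℤˣ → ℝ := fun z s =>
    (if z = x then ((s : ℤ) : ℝ) else 1) * ((if z = y then ((s : ℤ) : ℝ) else 1) *
      Real.exp (((s : ℤ) : ℝ) * a z)) with hg
  have hsummand : ∀ σ : SpinConfig V,
      spinAt x σ * spinAt y σ * Real.exp (spinVec σ ⬝ᵥ a) = ∏ z, g z (σ z) := by
    intro σ
    simp only [hg, Finset.prod_mul_distrib, Finset.prod_ite_eq', Finset.mem_univ, if_true,
      exp_spinVec_dotProduct, spinAt]
    ring
  simp_rw [hsummand, sum_prod_units]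
  -- evaluate the one-site sums
  have hplus : ∀ z, g z 1 + g z (-1) =
      (if z = x then Real.exp (a z) - Real.exp (-a z) else
        if z = y then Real.exp (a z) - Real.exp (-a z) else Real.exp (a z) + Real.exp (-a z)) := by
    intro z
    by_cases hzx : z = x
    · subst hzx
      simp [hg, hxy, sub_eq_add_neg]
    · by_cases hzy : z = y
      · subst hzy
        simp [hg, hzx, sub_eq_add_neg]
      · simp [hg, hzx, hzy]
  simp_rw [hplus]
  -- split off the factors at `x` and `y`
  have hy' : y ∈ univ.erase x := Finset.mem_erase.2 ⟨hxy.symm, Finset.mem_univ y⟩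
  rw [← Finset.mul_prod_erase _ _ (Finset.mem_univ x), ← Finset.mul_prod_erase _ _ hy']
  rw [← Finset.mul_prod_erase univ (fun z => Real.exp (a z) + Real.exp (-a z)) (Finset.mem_univ x),
    ← Finset.mul_prod_erase _ (fun z => Real.exp (a z) + Real.exp (-a z)) hy']
  simp only [if_true, hxy.symm, if_false]
  have hrest : ∏ z ∈ (univ.erase x).erase y,
      (if z = x then Real.exp (a z) - Real.exp (-a z) else
        if z = y then Real.exp (a z) - Real.exp (-a z) else Real.exp (a z) + Real.exp (-a z)) =
      ∏ z ∈ (univ.erase x).erase y, (Real.exp (a z) + Real.exp (-a z)) := by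
    refine Finset.prod_congr rfl fun z hz => ?_
    have hzy : z ≠ y := (Finset.mem_erase.1 hz).1
    have hzx : z ≠ x := (Finset.mem_erase.1 (Finset.mem_erase.1 hz).2).1
    simp [hzx, hzy]
  rw [hrest, Real.tanh_eq (a x), Real.tanh_eq (a y)]
  have hx0 : Real.exp (a x) + Real.exp (-a x) ≠ 0 := by positivity
  have hy0 : Real.exp (a y) + Real.exp (-a y) ≠ 0 := by positivity
  field_simp

/-- Product form of the field weight:
`fieldWeight M ψ = exp(-½ψᵀMψ) ∏_x (e^{(Mψ)_x} + e^{-(Mψ)_x})` (`= exp(-½ψᵀMψ) ∏ 2cosh((Mψ)_x)`). [cite: BauerschmidtBodineauDagallier2024Polchinski, §6.4.1] -/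
theorem fieldWeight_eq_exp_mul_prod (M : Matrix V V ℝ) (ψ : V → ℝ) :
    fieldWeight M ψ =
      gaussWeight M ψ * ∏ x, (Real.exp ((M *ᵥ ψ) x) + Real.exp (-(M *ᵥ ψ) x)) := by
  unfold fieldWeight jointWeight gaussWeight
  simp_rw [Real.exp_add, ← Finset.mul_sum, sum_exp_spinVec_dotProduct]

/-- The field weight is positive. [folklore] -/
theorem fieldWeight_pos (M : Matrix V V ℝ) (ψ : V → ℝ) : 0 < fieldWeight M ψ := by
  rw [fieldWeight_eq_exp_mul_prod]
  exact mul_pos (Real.exp_pos _) (Finset.prod_pos fun x _ => by positivity)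

/-- The conditional two-point read-out, pointwise in the field: for `x ≠ y`,
`fieldWeight(ψ) · tanh((Mψ)_x) tanh((Mψ)_y) = ∑_σ σ_xσ_y · jointWeight(σ, ψ)`. [cite: BauerschmidtBodineauDagallier2024Polchinski, §6.4.1] -/
theorem fieldWeight_mul_tanh_mul_tanh (M : Matrix V V ℝ) (ψ : V → ℝ) {x y : V} (hxy : x ≠ y) :
    fieldWeight M ψ * (Real.tanh ((M *ᵥ ψ) x) * Real.tanh ((M *ᵥ ψ) y)) =
      ∑ σ : SpinConfig V, spinAt x σ * spinAt y σ * jointWeight M σ ψ := by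
  unfold jointWeight
  simp_rw [Real.exp_add]
  calc fieldWeight M ψ * (Real.tanh ((M *ᵥ ψ) x) * Real.tanh ((M *ᵥ ψ) y))
      = gaussWeight M ψ * (Real.tanh ((M *ᵥ ψ) x) * Real.tanh ((M *ᵥ ψ) y) *
          ∏ z, (Real.exp ((M *ᵥ ψ) z) + Real.exp (-(M *ᵥ ψ) z))) := by
        rw [fieldWeight_eq_exp_mul_prod]; ring
    _ = gaussWeight M ψ *
          ∑ σ : SpinConfig V, spinAt x σ * spinAt y σ * Real.exp (spinVec σ ⬝ᵥ M *ᵥ ψ) := by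
        rw [sum_spin_mul_spin_mul_exp (M *ᵥ ψ) hxy]
    _ = ∑ σ : SpinConfig V, spinAt x σ * spinAt y σ *
          (Real.exp (-(ψ ⬝ᵥ M *ᵥ ψ) / 2) * Real.exp (spinVec σ ⬝ᵥ M *ᵥ ψ)) := by
        rw [gaussWeight, Finset.mul_sum]
        refine Finset.sum_congr rfl fun σ _ => ?_
        ring

/-- The field weight is integrable with `∫ fieldWeight = C_M ∑_σ e^{½σᵀMσ}`. [cite: BauerschmidtDagallier2023, §1.2] -/
theorem integral_fieldWeight {M : Matrix V V ℝ} {c : ℝ} (hM : IsCoercive M c) (hsymm : M.IsSymm) :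
    Integrable (fieldWeight M) ∧
      ∫ ψ, fieldWeight M ψ = (∑ σ : SpinConfig V, gibbsWeight M σ) * ∫ ψ, gaussWeight M ψ := by
  have hint : ∀ σ : SpinConfig V, Integrable (jointWeight M σ) :=
    fun σ => (integral_jointWeight hM hsymm σ).1
  have hfun : fieldWeight M = fun ψ => ∑ σ : SpinConfig V, jointWeight M σ ψ := rfl
  refine ⟨by rw [hfun]; exact integrable_finsetSum _ fun σ _ => hint σ, ?_⟩
  rw [hfun, integral_finsetSum _ fun σ _ => hint σ, Finset.sum_mul]
  exact Finset.sum_congr rfl fun σ _ => (integral_jointWeight hM hsymm σ).2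

/-- The two-point numerator: `∫ ∑_σ σ_xσ_y jointWeight(σ,ψ) dψ = C_M ∑_σ σ_xσ_y e^{½σᵀMσ}`. [cite: BauerschmidtDagallier2023, §1.2] -/
theorem integral_sum_spin_mul_spin_mul_jointWeight {M : Matrix V V ℝ} {c : ℝ} (hM : IsCoercive M c)
    (hsymm : M.IsSymm) (x y : V) :
    Integrable (fun ψ => ∑ σ : SpinConfig V, spinAt x σ * spinAt y σ * jointWeight M σ ψ) ∧
      ∫ ψ, ∑ σ : SpinConfig V, spinAt x σ * spinAt y σ * jointWeight M σ ψ =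
        (∑ σ : SpinConfig V, spinAt x σ * spinAt y σ * gibbsWeight M σ) *
          ∫ ψ, gaussWeight M ψ := by
  have hint : ∀ σ : SpinConfig V,
      Integrable (fun ψ => spinAt x σ * spinAt y σ * jointWeight M σ ψ) :=
    fun σ => (integral_jointWeight hM hsymm σ).1.const_mul _
  refine ⟨integrable_finsetSum _ fun σ _ => hint σ, ?_⟩
  rw [integral_finsetSum _ fun σ _ => hint σ, Finset.sum_mul]
  refine Finset.sum_congr rfl fun σ _ => ?_
  rw [integral_const_mul, (integral_jointWeight hM hsymm σ).2]
  ring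

/-! ### The field law and the exactness of the two-point read-out -/

/-- The field weight is continuous. [folklore] -/
theorem continuous_fieldWeight (M : Matrix V V ℝ) : Continuous (fieldWeight M) := by
  unfold fieldWeight jointWeight
  refine continuous_finsetSum _ fun σ _ => Real.continuous_exp.comp ?_
  refine ((continuous_quadForm M).neg.div_const _).add ?_
  unfold dotProduct mulVec
  fun_prop

/-- Integrals against the field law are normalised weighted Lebesgue integrals:
`∫ f dfieldMeasure = (∫ fieldWeight · f) / ∫ fieldWeight`. [folklore] -/
theorem integral_fieldMeasure {M : Matrix V V ℝ} {c : ℝ} (hM : IsCoercive M c) (hsymm : M.IsSymm)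
    (f : (V → ℝ) → ℝ) :
    ∫ ψ, f ψ ∂fieldMeasure M = (∫ ψ, fieldWeight M ψ * f ψ) / ∫ ψ, fieldWeight M ψ := by
  have hw := integral_fieldWeight hM hsymm
  have hmeas : Measurable fun ψ => ENNReal.ofReal (fieldWeight M ψ) :=
    ENNReal.measurable_ofReal.comp (continuous_fieldWeight M).measurable
  have hnn : 0 ≤ᵐ[volume] fieldWeight M :=
    Filter.Eventually.of_forall fun ψ => (fieldWeight_pos M ψ).le
  rw [fieldMeasure, integral_smul_measure, ← ofReal_integral_eq_lintegral_ofReal hw.1 hnn,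
    ENNReal.toReal_inv, ENNReal.toReal_ofReal (integral_nonneg fun ψ => (fieldWeight_pos M ψ).le),
    integral_withDensity_eq_integral_toReal_smul hmeas
      (Filter.Eventually.of_forall fun _ => ENNReal.ofReal_lt_top)]
  simp_rw [ENNReal.toReal_ofReal (fieldWeight_pos M _).le, smul_eq_mul]
  rw [div_eq_inv_mul]

/-- The field law of a symmetric coercive coupling operator is a probability measure. [cite: BauerschmidtBodineauDagallier2024Polchinski, §6.4.1] -/
theorem isProbabilityMeasure_fieldMeasure {M : Matrix V V ℝ} {c : ℝ} (hM : IsCoercive M c)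
    (hsymm : M.IsSymm) : IsProbabilityMeasure (fieldMeasure M) := by
  have hw := integral_fieldWeight hM hsymm
  have hnn : 0 ≤ᵐ[volume] fieldWeight M :=
    Filter.Eventually.of_forall fun ψ => (fieldWeight_pos M ψ).le
  have hpos : 0 < ∫ ψ, fieldWeight M ψ := by
    rw [hw.2]
    exact mul_pos (Finset.sum_pos (fun σ _ => gibbsWeight_pos M σ) Finset.univ_nonempty)
      (integral_gaussWeight_pos hM)
  constructor
  rw [fieldMeasure, Measure.smul_apply, withDensity_apply _ MeasurableSet.univ, Measure.restrict_univ,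
    ← ofReal_integral_eq_lintegral_ofReal hw.1 hnn, smul_eq_mul, ENNReal.inv_mul_cancel]
  · exact (ENNReal.ofReal_pos.2 hpos).ne'
  · exact ENNReal.ofReal_ne_top

/-- **Exactness of the two-point read-out (Kac–Siegert / Hubbard–Stratonovich).** For a symmetric
coercive coupling operator `M` and sites `x ≠ y`,
`∫ tanh((Mψ)_x) tanh((Mψ)_y) fieldMeasure(dψ) = ⟨σ_xσ_y⟩_M`: the Kac–Siegert field reproduces the
Ising two-point function through the conditional means `E[σ_x | ψ] = tanh((Mψ)_x)`
(the `t = 0` decomposition `E_μ F = E_ν E_{μ^φ} F` of BBD 2024 §6.4.1 applied to `F = σ_xσ_y`,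
with the conditional independence of the spins given the field). [cite: BauerschmidtBodineauDagallier2024Polchinski, §6.4.1] -/
theorem integral_tanh_mul_tanh_fieldMeasure {M : Matrix V V ℝ} {c : ℝ} (hM : IsCoercive M c)
    (hsymm : M.IsSymm) {x y : V} (hxy : x ≠ y) :
    ∫ ψ, Real.tanh ((M *ᵥ ψ) x) * Real.tanh ((M *ᵥ ψ) y) ∂fieldMeasure M = gibbsTwoPoint M x y := by
  rw [integral_fieldMeasure hM hsymm]
  simp_rw [fieldWeight_mul_tanh_mul_tanh M _ hxy]
  rw [(integral_sum_spin_mul_spin_mul_jointWeight hM hsymm x y).2, (integral_fieldWeight hM hsymm).2,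
    gibbsTwoPoint, mul_div_mul_right _ _ (integral_gaussWeight_pos hM).ne']

end KacSiegert

end Literature.Probability.LatticeModels
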